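import Summits.NavierStokesRegularity.NavierStokesRegularity.Theorems.PerpetualPumpAveragedTypeIBlowupWellposedTools
import Summits.NavierStokesRegularity.NavierStokesRegularity.Theorems.PerpetualPumpAveragedTypeIBlowupChainContinuation

/-!
# Crux `PerpetualPump.AveragedTypeIBlowup` (stmt-NavierStokesRegularity-1835), line `Sketch`:
# the stub `wellposed` — local existence, persistence and Lipschitz dependence on the datum

T. Tao, *Finite time blowup for an averaged three-dimensional Navier–Stokes equation*, J. Amer.
Math. Soc. **29** (2016), 601–674 = arXiv:1402.0290v3, §4, proof of Lemma 4.1, p. 22, (4.14):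
pairing the wavelet Duhamel formula (4.14) with `ψ_{i,n}` gives the exact Volterra chain of the
coefficients, `Y_{i,n}(t) = A 1_{(i,n)=(i₀,n₀)} k_{i,n}(t) + ∫₀ᵗ k_{i,n}(t-s) quadTerm(Y)_{i,n}(s) ds`,
with the heat kernels of the modes `k_{i,n}(τ) = Re⟨e^{τΔ}ψ_{i,n}, ψ_{i,n}⟩` (continuous, `|k_{i,n}| ≤ 1`).

This file proves the registered stub `stub_wellposed` of the lead's skeleton
`Cruxes/AveragedTypeIBlowup/Lines/Sketch.lean`, verbatim: (i) for every amplitude `A` the chain from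
the single-mode datum `A ψ_{i₀,n₀}` has a solution in the line's class (continuous on `[0,S)`, no
modes below `n₀`, `(1+ε₀)^{20n}`-bounded on compact sub-intervals) on some `[0,S)`, `S > 0`;
(ii) persistence with Lipschitz dependence — if the solution from `A` lives on `[0,S)` then every
nearby datum `A'` has a solution living beyond any `S' < S`, `L`-Lipschitz close to it in the weight
`(1+ε₀)^{10n}` on `[0,S']`. The argument (`persist_of_kernel`, general continuous kernels `|k| ≤ 1`)
marches in finitely many Picard steps of a fixed length on `[0,T]`, `T = (S'+S)/2`: the size `R` of
every restart forcing met is controlled a priori because the marching solution stays `1`-close to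
`Y` in the weight `20` (`persist_step`: each step multiplies the distance bound by a fixed factor,
and `|A'-A| < δ₀` makes the final bound `≤ 1`).

Nothing here changes a statement of the route; the file lands with `--supports`.

## References

* T. Tao, J. Amer. Math. Soc. 29 (2016), 601–674, arXiv:1402.0290v3, §4 p. 22 (4.14).
  [`Tao2016AveragedNS`]
-/

noncomputable section

-- the summit namespace `…NavierStokesRegularity.NavierStokesRegularity…` is the tree convention
set_option linter.dupNamespace false

open MeasureTheory Set Filter Topology
open scoped ENNReal
open Literature.Analysis.FluidPDE Literature.Analysis.FluidPDE.Tao2016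
open Literature.Analysis.FluidPDE.TaoCascade (quadTerm shiftSet mem_shiftSet_iff)

namespace Summit.NavierStokesRegularity.NavierStokesRegularity.Theorems.PerpetualPumpAveragedTypeIBlowup

variable {ε₀ : ℝ} {m : ℕ}

/-! ### Persistence with Lipschitz dependence for a general kernel -/

/-- **Persistence and Lipschitz dependence on the datum, for general continuous kernels `|k_{i,n}| ≤ 1`.**
Let `Y` solve the chain from the datum `A` on `[0,T]`, `T > 0` (continuous, no modes below `n₀`,
`(1+ε₀)^{20n}|Y| ≤ ρ_Y`). There are `L ≥ 0` and `δ₀ > 0` such that for every `A'` with `|A'-A| < δ₀` the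
chain from `A'` has a continuous solution `Y'` on `[0,T]`, no modes below `n₀`, with
`(1+ε₀)^{20n}|Y'| ≤ ρ_Y + 1` and `(1+ε₀)^{20n}|Y - Y'| ≤ L|A'-A|` on `[0,T]`: march in `N = ⌈T/h⌉` steps
of length `T/N ≤ h = min(δ, 1/(2Λ₂+2))` (`δ` the Picard time of `stub_chainContinuationPicard` for the
size `R` of all restart forcings met), each step (`persist_step`) multiplying the distance bound by
`M = 2TΛ₁+2`; `L = 2(1+ε₀)^{20n₀}M^N` and `Lδ₀ ≤ 1` keeps the marching solution `1`-close to `Y`. [cite: Tao2016AveragedNS, §4 p. 22 (4.14)] -/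
theorem persist_of_kernel (hε₀ : 0 < ε₀) (α : Fin m → Fin m → Fin m → ℤ × ℤ × ℤ → ℝ)
    (k : Fin m → ℤ → ℝ → ℝ) (hk1 : ∀ i n τ, |k i n τ| ≤ 1) (hkc : ∀ i n, Continuous (k i n))
    (i₀ : Fin m) (n₀ : ℤ) (A : ℝ) {T ρY : ℝ} (hT : 0 < T) (hρY : 0 ≤ ρY) {Y : Fin m → ℤ → ℝ → ℝ}
    (hYc : ∀ i n, ContinuousOn (Y i n) (Icc 0 T)) (hY0 : ∀ i n t, n < n₀ → Y i n t = 0)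
    (hYb : ∀ (i : Fin m) (n : ℤ), ∀ t ∈ Icc 0 T, (1 + ε₀) ^ ((20 : ℝ) * n) * |Y i n t| ≤ ρY)
    (hYeq : ∀ (i : Fin m) (n : ℤ), ∀ t ∈ Icc 0 T,
      Y i n t = (if i = i₀ ∧ n = n₀ then A else 0) * k i n t +
        ∫ s in (0 : ℝ)..t, k i n (t - s) * quadTerm ε₀ α Y i n s) :
    ∃ L δ₀ : ℝ, 0 ≤ L ∧ 0 < δ₀ ∧ ∀ A' : ℝ, |A' - A| < δ₀ → ∃ Y' : Fin m → ℤ → ℝ → ℝ,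
      (∀ i n, Continuous (Y' i n)) ∧ (∀ i n t, n < n₀ → Y' i n t = 0) ∧
      (∀ (i : Fin m) (n : ℤ), ∀ t ∈ Icc 0 T, (1 + ε₀) ^ ((20 : ℝ) * n) * |Y' i n t| ≤ ρY + 1) ∧
      (∀ (i : Fin m) (n : ℤ), ∀ t ∈ Icc 0 T,
        Y' i n t = (if i = i₀ ∧ n = n₀ then A' else 0) * k i n t +
          ∫ s in (0 : ℝ)..t, k i n (t - s) * quadTerm ε₀ α Y' i n s) ∧
      ∀ (i : Fin m) (n : ℤ), ∀ t ∈ Icc 0 T,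
        (1 + ε₀) ^ ((20 : ℝ) * n) * |Y i n t - Y' i n t| ≤ L * |A' - A| := by
  have hL0 : 0 < 1 + ε₀ := by linarith
  -- constants
  set K : ℝ := ∑ i₃ : Fin m, ∑ i₁ : Fin m, ∑ i₂ : Fin m, ∑ μ ∈ shiftSet, |α i₁ i₂ i₃ μ| with hK
  have hK0 : 0 ≤ K := by positivity
  clear_value K
  set Λ₁ : ℝ := K * (2 * (ρY + 1)) * (1 + ε₀) ^ ((75 : ℝ) / 2 - (35 : ℝ) / 2 * n₀) with hΛ₁
  have hΛ₁0 : 0 ≤ Λ₁ := by rw [hΛ₁]; positivity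
  clear_value Λ₁
  set R : ℝ := (1 + ε₀) ^ ((20 : ℝ) * n₀) * (|A| + 1) + T * Λ₁ * (ρY + 1) + ρY with hR
  have hR1 : (1 + ε₀) ^ ((20 : ℝ) * n₀) * (|A| + 1) + T * Λ₁ * (ρY + 1) ≤ R := by rw [hR]; linarith
  have hR0 : 0 ≤ R := le_trans (by positivity) hR1
  have hRρ : ρY ≤ 2 * R + 1 := by
    have h1 : 0 ≤ (1 + ε₀) ^ ((20 : ℝ) * n₀) * (|A| + 1) + T * Λ₁ * (ρY + 1) := by positivity
    rw [hR]
    linarith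
  clear_value R
  set Λ₂ : ℝ := K * (2 * (2 * R + 1)) * (1 + ε₀) ^ ((75 : ℝ) / 2 - (35 : ℝ) / 2 * n₀) with hΛ₂
  have hΛ₂0 : 0 ≤ Λ₂ := by rw [hΛ₂]; positivity
  clear_value Λ₂
  obtain ⟨δ, hδ0, hP⟩ := stub_chainContinuationPicard hε₀ α n₀ R hR0
  -- the step
  set h : ℝ := min δ (1 / (2 * Λ₂ + 2)) with hh
  have hh0 : 0 < h := lt_min hδ0 (by positivity)
  have hhδ : h ≤ δ := min_le_left _ _
  have hhΛ : h * Λ₂ ≤ 1 / 2 := by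
    have h1 : h ≤ 1 / (2 * Λ₂ + 2) := min_le_right _ _
    calc h * Λ₂ ≤ 1 / (2 * Λ₂ + 2) * Λ₂ := mul_le_mul_of_nonneg_right h1 hΛ₂0
      _ ≤ 1 / 2 := by
          rw [div_mul_eq_mul_div, one_mul, div_le_iff₀ (by positivity)]
          linarith
  clear_value h
  set N : ℕ := ⌈T / h⌉₊ with hN
  have hN0 : 0 < N := Nat.ceil_pos.2 (div_pos hT hh0)
  have hN0' : (0 : ℝ) < N := Nat.cast_pos.2 hN0
  set s : ℝ := T / N with hs
  have hs0 : 0 < s := div_pos hT hN0'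
  have hsh : s ≤ h := by
    rw [hs, div_le_iff₀ hN0']
    have h1 : T / h ≤ N := Nat.le_ceil (T / h)
    calc T = T / h * h := by field_simp
      _ ≤ N * h := mul_le_mul_of_nonneg_right h1 hh0.le
      _ = h * N := mul_comm _ _
  have hNs : (N : ℝ) * s = T := by rw [hs]; field_simp
  clear_value s
  -- the growth factor of the distance bound per step
  set M : ℝ := 2 * (T * Λ₁) + 2 with hM
  have hM1 : 1 ≤ M := by
    have h1 := mul_nonneg hT.le hΛ₁0
    rw [hM]
    linarith
  set G₀ : ℝ := 2 * (1 + ε₀) ^ ((20 : ℝ) * n₀) with hG₀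
  have hG₀0 : 0 ≤ G₀ := by rw [hG₀]; positivity
  refine ⟨G₀ * M ^ N, min 1 (1 / (G₀ * M ^ N + 1)), by positivity, lt_min one_pos (by positivity),
    fun A' hA' => ?_⟩
  have hA'1 : |A' - A| ≤ 1 := (hA'.trans_le (min_le_left _ _)).le
  have hA'G : G₀ * M ^ N * |A' - A| ≤ 1 := by
    have h1 : |A' - A| ≤ 1 / (G₀ * M ^ N + 1) := (hA'.trans_le (min_le_right _ _)).le
    calc G₀ * M ^ N * |A' - A| ≤ G₀ * M ^ N * (1 / (G₀ * M ^ N + 1)) :=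
          mul_le_mul_of_nonneg_left h1 (by positivity)
      _ ≤ 1 := by
          rw [mul_one_div, div_le_one (by positivity)]
          linarith
  -- marching
  have hind : ∀ j : ℕ, j ≤ N → ∃ Z : Fin m → ℤ → ℝ → ℝ, (∀ i n, Continuous (Z i n)) ∧
      (∀ i n t, n < n₀ → Z i n t = 0) ∧
      (∀ (i : Fin m) (n : ℤ), ∀ t ∈ Icc 0 ((j : ℝ) * s),
        Z i n t = (if i = i₀ ∧ n = n₀ then A' else 0) * k i n t +
          ∫ u in (0 : ℝ)..t, k i n (t - u) * quadTerm ε₀ α Z i n u) ∧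
      ∀ (i : Fin m) (n : ℤ), ∀ t ∈ Icc 0 ((j : ℝ) * s),
        (1 + ε₀) ^ ((20 : ℝ) * n) * |Y i n t - Z i n t| ≤ G₀ * M ^ j * |A' - A| := by
    intro j
    induction j with
    | zero =>
      intro _
      obtain ⟨Z₀, hZ₀⟩ : ∃ Z₀ : Fin m → ℤ → ℝ → ℝ, ∀ i n t,
          Z₀ i n t = (if i = i₀ ∧ n = n₀ then A' else 0) * k i n t := ⟨_, fun _ _ _ => rfl⟩
      refine ⟨Z₀, fun i n => ?_, fun i n t hn => ?_, fun i n t ht => ?_, fun i n t ht => ?_⟩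
      · rw [show Z₀ i n = fun t => (if i = i₀ ∧ n = n₀ then A' else 0) * k i n t from funext (hZ₀ i n)]
        exact continuous_const.mul (hkc i n)
      · have hne : ¬(i = i₀ ∧ n = n₀) := fun hc => by
          rw [hc.2] at hn
          exact lt_irrefl _ hn
        rw [hZ₀, if_neg hne, zero_mul]
      · have ht0 : t = 0 := le_antisymm (by simpa using ht.2) ht.1
        rw [ht0, hZ₀, intervalIntegral.integral_same, add_zero]
      · have ht0 : t = 0 := le_antisymm (by simpa using ht.2) ht.1
        rw [ht0, hZ₀, hYeq i n 0 ⟨le_rfl, hT.le⟩, intervalIntegral.integral_same, add_zero, ← sub_mul,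
          pow_zero, mul_one]
        split_ifs with hc
        · rw [hc.2, abs_mul, abs_sub_comm]
          calc (1 + ε₀) ^ ((20 : ℝ) * n₀) * (|A' - A| * |k i n₀ 0|)
              ≤ (1 + ε₀) ^ ((20 : ℝ) * n₀) * (|A' - A| * 1) := by
                gcongr
                exact hk1 i n₀ 0
            _ ≤ G₀ * |A' - A| := by
                have h1 := mul_nonneg (Real.rpow_nonneg hL0.le ((20 : ℝ) * n₀)) (abs_nonneg (A' - A))
                rw [hG₀, mul_one]
                linarith
        · rw [sub_zero, zero_mul, abs_zero, mul_zero]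
          positivity
    | succ j ih =>
      intro hj
      obtain ⟨Z, hZc, hZ0, hZeq, hZd⟩ := ih (Nat.le_of_succ_le hj)
      have hj' : (j : ℝ) + 1 ≤ N := by exact_mod_cast hj
      have hMj : 1 ≤ M ^ j := one_le_pow₀ hM1
      have hMjN : M ^ j ≤ M ^ N := pow_le_pow_right₀ hM1 (Nat.le_of_succ_le hj)
      have hD1 : G₀ * M ^ j * |A' - A| ≤ 1 :=
        le_trans (mul_le_mul_of_nonneg_right (mul_le_mul_of_nonneg_left hMjN hG₀0) (abs_nonneg _)) hA'G
      have hb : (j : ℝ) * s ≤ ((j : ℝ) + 1) * s := mul_le_mul_of_nonneg_right (by linarith) hs0.le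
      have hbT : ((j : ℝ) + 1) * s ≤ T := by rw [← hNs]; exact mul_le_mul_of_nonneg_right hj' hs0.le
      have hbΛ : (((j : ℝ) + 1) * s - j * s) * Λ₂ ≤ 1 / 2 := by
        calc (((j : ℝ) + 1) * s - j * s) * Λ₂ = s * Λ₂ := by ring
          _ ≤ h * Λ₂ := mul_le_mul_of_nonneg_right hsh hΛ₂0
          _ ≤ 1 / 2 := hhΛ
      obtain ⟨Z', hZ'c, hZ'0, hZ'eq, hZ'd⟩ := persist_step hε₀ α k hk1 hkc i₀ n₀ hK hΛ₁ hΛ₂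
        (by positivity : (0 : ℝ) ≤ (j : ℝ) * s) hb hbT hρY (by positivity : (0 : ℝ) ≤ G₀ * M ^ j * |A' - A|) hD1 hA'1 hR1 hRρ hbΛ
        (fun F hFc hF0 hFR => by
          obtain ⟨X, h1, h2, h3, h4, -⟩ := hP k F ((j : ℝ) * s) (((j : ℝ) + 1) * s) hb
            (by rw [add_mul, one_mul]; linarith : ((j : ℝ) + 1) * s ≤ j * s + δ) hk1 hkc hFc hF0 hFR
          exact ⟨X, h1, h2, h3, h4⟩)
        hYc hY0 hYb hYeq hZc hZ0 hZeq hZd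
      push_cast
      refine ⟨Z', hZ'c, hZ'0, hZ'eq, fun i n t ht => (hZ'd i n t ht).trans ?_⟩
      calc 2 * ((1 + ε₀) ^ ((20 : ℝ) * n₀) * |A' - A|) + (2 * (T * Λ₁) + 1) * (G₀ * M ^ j * |A' - A|)
          = (G₀ * 1 + (M - 1) * (G₀ * M ^ j)) * |A' - A| := by rw [hG₀, hM]; ring
        _ ≤ (G₀ * M ^ j + (M - 1) * (G₀ * M ^ j)) * |A' - A| := by gcongr
        _ = G₀ * M ^ (j + 1) * |A' - A| := by rw [pow_succ]; ring
  obtain ⟨Z, hZc, hZ0, hZeq, hZd⟩ := hind N le_rfl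
  rw [hNs] at hZeq hZd
  refine ⟨Z, hZc, hZ0, fun i n t ht => ?_, hZeq, hZd⟩
  have h3 : |Z i n t| ≤ |Y i n t| + |Y i n t - Z i n t| := by
    have := abs_sub_abs_le_abs_sub (Z i n t) (Y i n t)
    rw [abs_sub_comm] at this
    linarith
  calc (1 + ε₀) ^ ((20 : ℝ) * n) * |Z i n t|
      ≤ (1 + ε₀) ^ ((20 : ℝ) * n) * (|Y i n t| + |Y i n t - Z i n t|) :=
        mul_le_mul_of_nonneg_left h3 (Real.rpow_nonneg hL0.le _)
    _ ≤ ρY + G₀ * M ^ N * |A' - A| := by rw [mul_add]; exact add_le_add (hYb i n t ht) (hZd i n t ht)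
    _ ≤ ρY + 1 := by linarith

/-! ### The registered stub -/

/-- **Stub `wellposed`** (registered stub of the line `Sketch` of the crux `PerpetualPump.AveragedTypeIBlowup`,
verbatim). Local well-posedness of the exact Volterra chain from the single-mode datum `A ψ_{i₀,n₀}` in the
class used by the line (continuous, no modes below `n₀`, `(1+ε₀)^{20n}`-bounded on compact sub-intervals):
(i) a solution exists on some `[0,S)`, `S > 0` (`local_of_kernel`); (ii) persistence with Lipschitz
dependence — if the solution from `A` lives on `[0,S)` then, with `T = (S'+S)/2`, every datum `A'` with
`|A'-A| < δ₀` has a solution on `[0,T)`, `T > S'`, whose weight-`20` distance to it on `[0,T]` is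
`≤ L|A'-A|` (`persist_of_kernel`), whence the weight-`10` bound with `(1+ε₀)^{-10n₀}L` (no modes below
`n₀`). The kernels `k_{i,n}(τ) = Re⟨e^{τΔ}ψ_{i,n}, ψ_{i,n}⟩` are continuous with `|k_{i,n}| ≤ 1`. [cite: Tao2016AveragedNS, §4 p. 22 (4.14)] -/
theorem stub_wellposed :
    ∀ {ε₀ : ℝ}, 0 < ε₀ → ε₀ ≤ 1 → ∀ {m : ℕ} (𝒟 : CascadeWaveletData ε₀ m)
      (α : Fin m → Fin m → Fin m → ℤ × ℤ × ℤ → ℝ) (i₀ : Fin m) (n₀ : ℤ),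
      (∀ A : ℝ, ∃ (S : ℝ) (Y : Fin m → ℤ → ℝ → ℝ), 0 < S ∧
        (∀ i n, ContinuousOn (Y i n) (Ico 0 S)) ∧
        (∀ i n t, n < n₀ → Y i n t = 0) ∧
        (∀ S' : ℝ, S' < S → ∃ C : ℝ, ∀ (i : Fin m) (n : ℤ), ∀ t ∈ Icc 0 S',
          (1 + ε₀) ^ ((20 : ℝ) * n) * |Y i n t| ≤ C) ∧
        (∀ (i : Fin m) (n : ℤ), ∀ t ∈ Ico 0 S,
          Y i n t = (if i = i₀ ∧ n = n₀ then A else 0) *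
              (pairing (heat t (cascadeWavelet ε₀ (𝒟.ψ i) n)) (cascadeWavelet ε₀ (𝒟.ψ i) n)).re +
            ∫ s in (0 : ℝ)..t,
              (pairing (heat (t - s) (cascadeWavelet ε₀ (𝒟.ψ i) n)) (cascadeWavelet ε₀ (𝒟.ψ i) n)).re *
                quadTerm ε₀ α Y i n s)) ∧
      (∀ (A S S' C : ℝ) (Y : Fin m → ℤ → ℝ → ℝ), 0 ≤ S' → S' < S →
        (∀ i n, ContinuousOn (Y i n) (Ico 0 S)) →
        (∀ i n t, n < n₀ → Y i n t = 0) →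
        (∀ S'' : ℝ, S'' < S → ∃ C' : ℝ, ∀ (i : Fin m) (n : ℤ), ∀ t ∈ Icc 0 S'',
          (1 + ε₀) ^ ((20 : ℝ) * n) * |Y i n t| ≤ C') →
        (∀ (i : Fin m) (n : ℤ), ∀ t ∈ Ico 0 S,
          Y i n t = (if i = i₀ ∧ n = n₀ then A else 0) *
              (pairing (heat t (cascadeWavelet ε₀ (𝒟.ψ i) n)) (cascadeWavelet ε₀ (𝒟.ψ i) n)).re +
            ∫ s in (0 : ℝ)..t,
              (pairing (heat (t - s) (cascadeWavelet ε₀ (𝒟.ψ i) n)) (cascadeWavelet ε₀ (𝒟.ψ i) n)).re *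
                quadTerm ε₀ α Y i n s) →
        (∀ (i : Fin m) (n : ℤ), ∀ t ∈ Icc 0 S', (1 + ε₀) ^ ((10 : ℝ) * n) * |Y i n t| ≤ C) →
        ∃ L δ₀ : ℝ, 0 < δ₀ ∧ ∀ A' : ℝ, |A' - A| < δ₀ →
          ∃ (S'' : ℝ) (Y' : Fin m → ℤ → ℝ → ℝ), S' < S'' ∧
            (∀ i n, ContinuousOn (Y' i n) (Ico 0 S'')) ∧
            (∀ i n t, n < n₀ → Y' i n t = 0) ∧
            (∀ T : ℝ, T < S'' → ∃ C' : ℝ, ∀ (i : Fin m) (n : ℤ), ∀ t ∈ Icc 0 T,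
              (1 + ε₀) ^ ((20 : ℝ) * n) * |Y' i n t| ≤ C') ∧
            (∀ (i : Fin m) (n : ℤ), ∀ t ∈ Ico 0 S'',
              Y' i n t = (if i = i₀ ∧ n = n₀ then A' else 0) *
                  (pairing (heat t (cascadeWavelet ε₀ (𝒟.ψ i) n)) (cascadeWavelet ε₀ (𝒟.ψ i) n)).re +
                ∫ s in (0 : ℝ)..t,
                  (pairing (heat (t - s) (cascadeWavelet ε₀ (𝒟.ψ i) n)) (cascadeWavelet ε₀ (𝒟.ψ i) n)).re *
                    quadTerm ε₀ α Y' i n s) ∧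
            ∀ (i : Fin m) (n : ℤ), ∀ t ∈ Icc 0 S',
              (1 + ε₀) ^ ((10 : ℝ) * n) * |Y i n t - Y' i n t| ≤ L * |A - A'|) := by
  intro ε₀ hε₀ _hε₁ m 𝒟 α i₀ n₀
  have hL0 : 0 < 1 + ε₀ := by linarith
  have hL1 : 1 ≤ 1 + ε₀ := by linarith
  have hk1 : ∀ (i : Fin m) (n : ℤ) (τ : ℝ),
      |(pairing (heat τ (cascadeWavelet ε₀ (𝒟.ψ i) n)) (cascadeWavelet ε₀ (𝒟.ψ i) n)).re| ≤ 1 :=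
    fun i n τ => abs_re_pairing_heat_cascadeWavelet_le hε₀ 𝒟 i n τ
  have hkc : ∀ (i : Fin m) (n : ℤ), Continuous fun τ : ℝ =>
      (pairing (heat τ (cascadeWavelet ε₀ (𝒟.ψ i) n)) (cascadeWavelet ε₀ (𝒟.ψ i) n)).re :=
    fun i n => continuous_re_pairing_heat_cascadeWavelet 𝒟 i n
  refine ⟨fun A => local_of_kernel hε₀ α
    (fun i n τ => (pairing (heat τ (cascadeWavelet ε₀ (𝒟.ψ i) n)) (cascadeWavelet ε₀ (𝒟.ψ i) n)).re)
    hk1 hkc i₀ n₀ A, ?_⟩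
  intro A S S' C Y hS'0 hS'S hcont hlow hdec hchain _hC
  -- work on `[0, T]`, `S' < T < S`
  set T : ℝ := (S' + S) / 2 with hT
  have hT0 : 0 < T := by rw [hT]; linarith
  have hS'T : S' < T := by rw [hT]; linarith
  have hTS : T < S := by rw [hT]; linarith
  clear_value T
  have hIccT : Icc 0 T ⊆ Ico 0 S := fun t ht => ⟨ht.1, ht.2.trans_lt hTS⟩
  obtain ⟨C', hC'⟩ := hdec T hTS
  have hC'0 : 0 ≤ C' :=
    le_trans (mul_nonneg (Real.rpow_nonneg hL0.le _) (abs_nonneg _)) (hC' i₀ n₀ 0 ⟨le_rfl, hT0.le⟩)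
  obtain ⟨L, δ₀, hL, hδ₀, hper⟩ := persist_of_kernel hε₀ α
    (fun i n τ => (pairing (heat τ (cascadeWavelet ε₀ (𝒟.ψ i) n)) (cascadeWavelet ε₀ (𝒟.ψ i) n)).re)
    hk1 hkc i₀ n₀ A hT0 hC'0 (Y := Y) (fun i n => (hcont i n).mono hIccT) hlow hC'
    (fun i n t ht => hchain i n t (hIccT ht))
  refine ⟨(1 + ε₀) ^ (-((10 : ℝ) * n₀)) * L, δ₀, hδ₀, fun A' hA' => ?_⟩
  obtain ⟨Y', hY'c, hY'0, hY'b, hY'eq, hY'd⟩ := hper A' hA'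
  refine ⟨T, Y', hS'T, fun i n => (hY'c i n).continuousOn, hY'0,
    fun T' hT' => ⟨C' + 1, fun i n t ht => hY'b i n t ⟨ht.1, ht.2.trans hT'.le⟩⟩,
    fun i n t ht => hY'eq i n t ⟨ht.1, ht.2.le⟩, fun i n t ht => ?_⟩
  -- the weight-`10` Lipschitz bound on `[0, S']`
  rcases lt_or_ge n n₀ with hn | hn
  · rw [hlow i n t hn, hY'0 i n t hn, sub_zero, abs_zero, mul_zero]
    positivity
  have hd := hY'd i n t ⟨ht.1, ht.2.trans hS'T.le⟩
  have he : -((10 : ℝ) * n) + (20 : ℝ) * n = (10 : ℝ) * n := by ring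
  have hn' : (n₀ : ℝ) ≤ n := by exact_mod_cast hn
  calc (1 + ε₀) ^ ((10 : ℝ) * n) * |Y i n t - Y' i n t|
      = (1 + ε₀) ^ (-((10 : ℝ) * n)) * ((1 + ε₀) ^ ((20 : ℝ) * n) * |Y i n t - Y' i n t|) := by
        rw [← mul_assoc, ← Real.rpow_add hL0, he]
    _ ≤ (1 + ε₀) ^ (-((10 : ℝ) * n)) * (L * |A' - A|) :=
        mul_le_mul_of_nonneg_left hd (Real.rpow_nonneg hL0.le _)
    _ ≤ (1 + ε₀) ^ (-((10 : ℝ) * n₀)) * (L * |A' - A|) :=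
        mul_le_mul_of_nonneg_right (Real.rpow_le_rpow_of_exponent_le hL1 (by linarith)) (by positivity)
    _ = (1 + ε₀) ^ (-((10 : ℝ) * n₀)) * L * |A - A'| := by rw [abs_sub_comm, mul_assoc]

end Summit.NavierStokesRegularity.NavierStokesRegularity.Theorems.PerpetualPumpAveragedTypeIBlowup

end
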